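import Literature.NumberTheory.EllipticCurves.ModularFormsLevelCusps
import Literature.NumberTheory.EllipticCurves.ModularFormsGamma1PlusMinus
import Literature.NumberTheory.EllipticCurves.ModularCurveGenusIntegralityProofs
import HarnessLib

/-!
# The `⟨T⟩`-orbits on `SL₂(ℤ)/Γ` are the cusps of `Γ` (Mathlib's `CuspOrbits`), for every
# finite-index `Γ ∋ -1`; the cusps of `Γ` and of `±Γ`; the cusps of `Γ₁(N)`

The dimension bounds of `ModularFormsGamma1Dimension` / `ModularFormsGamma1OddDimension` carry the
orbit count `#Level.basePoints (±Γ₁(N))` — the number of `⟨T⟩`-orbits on `SL₂(ℤ)/±Γ₁(N)`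
(`Level.basePointsEquiv`). This file identifies it with the number of cusps in Mathlib's sense
(`CuspOrbits`, orbits of `Γ` on its own cusps `= ℙ¹(ℚ)`), generalising the `Γ₀(N)` bridge
`card_orbits_T_eq_nuInfty` of `ModularCurveGenusIntegralityProofs`:

* `Level.cuspOf`, `Level.cuspOrbitOf` (`g ↦ Γ g ∞`), `cuspOrbitOf_surjective`,
  `cuspOrbitOf_eq_iff` (`Γ g∞ = Γ g'∞ ↔ ∃ γ ∈ Γ, (g⁻¹γg')₁₀ = 0`) — the `Γ₀(N)` declarations of
  `ModularCurveCuspsProofs` for a general finite-index `Γ`;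
* **`Level.card_cuspOrbits_eq_card_basePoints`** (`-1 ∈ Γ`):
  `#CuspOrbits(Γ) = #Level.basePoints Γ` — `gΓ ↦ Γ g⁻¹ ∞` is a bijection from `⟨T⟩\SL₂(ℤ)/Γ`
  onto `Γ\ℙ¹(ℚ)` (an upper triangular element of `SL₂(ℤ)` is `±Tʲ`; Diamond–Shurman §3.8);
* `OnePoint.neg_smul'` (`(-g) • c = g • c` on `ℙ¹`, with `mapGL_neg` of `ModularCurveProofs`),
  **`Level.card_cuspOrbits_eq_adjoinNegI`**:
  `#CuspOrbits(Γ) = #CuspOrbits(±Γ)` for every finite-index `Γ` (same cusps, same orbits);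
* **`card_cuspOrbits_gamma1`**: `#CuspOrbits(Γ₁(N)) = #Level.basePoints(±Γ₁(N))` — the `ε_∞` of
  the dimension bounds is the number of cusps of `Γ₁(N)`.

Everything is proved; no named facts.

## References

* F. Diamond, J. Shurman, *A first course in modular forms*, GTM 228 (2005), §3.8 (Lemma 3.8.1).
* G. Shimura, *Introduction to the arithmetic theory of automorphic functions* (1971), §1.6.
-/

noncomputable section

open CongruenceSubgroup Matrix.SpecialLinearGroup ModularGroup MulAction OnePoint
open scoped MatrixGroups ModularForm

namespace Literature.NumberTheory.EllipticCurves.ModularForms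

/-! ### `-g` acts as `g` on `ℙ¹` -/

/-- `(-g) • c = g • c` on `ℙ¹(K)` (Möbius transformations of `-g` and `g` agree). [folklore] -/
theorem OnePoint.neg_smul' {K : Type*} [Field K] [DecidableEq K] (g : GL (Fin 2) K) (c : OnePoint K) :
    (-g) • c = g • c := by
  have he : ∀ i j, (-g : GL (Fin 2) K) i j = -(g i j) := fun i j ↦ by
    rw [Units.val_neg, Matrix.neg_apply]
  cases c with
  | infty =>
    rw [smul_infty_eq_ite, smul_infty_eq_ite, he, he]
    simp only [neg_eq_zero, neg_div_neg_eq]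
  | coe k =>
    rw [smul_some_eq_ite, smul_some_eq_ite, he, he, he, he]
    have h1 : -(g 1 0) * k + -(g 1 1) = -(g 1 0 * k + g 1 1) := by ring
    have h2 : -(g 0 0) * k + -(g 0 1) = -(g 0 0 * k + g 0 1) := by ring
    simp only [h1, h2, neg_eq_zero, neg_div_neg_eq]

namespace Level

/-! ### Cusp orbits of a level `Γ` -/

section CuspOrbits

variable (Γ : Subgroup SL(2, ℤ)) [Γ.FiniteIndex]

/-- The cusp `g ∞ ∈ ℙ¹(ℚ)` as a cusp of `Γ`. [folklore] -/
def cuspOf (g : SL(2, ℤ)) : cuspsSubMulAction (Γ : Subgroup (GL (Fin 2) ℝ)) :=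
  ⟨mapGL ℝ g • ∞, (Subgroup.IsArithmetic.isCusp_iff_isCusp_SL2Z _).mpr
    (isCusp_SL2Z_iff'.mpr ⟨g, rfl⟩)⟩

/-- The cusp orbit `Γ g ∞ ∈ Γ\ℙ¹(ℚ)`. [folklore] -/
def cuspOrbitOf (g : SL(2, ℤ)) : _root_.CuspOrbits (Γ : Subgroup (GL (Fin 2) ℝ)) :=
  Quotient.mk _ (cuspOf Γ g)

/-- Every cusp orbit is `Γ g ∞` for some `g ∈ SL₂(ℤ)`. [folklore] -/
theorem cuspOrbitOf_surjective : Function.Surjective (cuspOrbitOf Γ) := by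
  rintro ⟨c, hc⟩
  have hc' : IsCusp c (Γ : Subgroup (GL (Fin 2) ℝ)) := hc
  rw [Subgroup.IsArithmetic.isCusp_iff_isCusp_SL2Z, isCusp_SL2Z_iff'] at hc'
  obtain ⟨g, rfl⟩ := hc'
  exact ⟨g, rfl⟩

/-- `Γ g ∞ = Γ g' ∞ ↔ ∃ γ ∈ Γ, (g⁻¹ γ g') ∞ = ∞` (Diamond–Shurman Lemma 3.8.1). [folklore] -/
theorem cuspOrbitOf_eq_iff (g g' : SL(2, ℤ)) :
    cuspOrbitOf Γ g = cuspOrbitOf Γ g' ↔ ∃ γ ∈ Γ, (g⁻¹ * γ * g') 1 0 = 0 := by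
  rw [cuspOrbitOf, cuspOrbitOf, Quotient.eq, MulAction.orbitRel_apply, MulAction.mem_orbit_iff]
  constructor
  · rintro ⟨⟨_, γ, hγ, rfl⟩, h⟩
    refine ⟨γ, hγ, ?_⟩
    have h' := congrArg Subtype.val h
    change mapGL ℝ γ • mapGL ℝ g' • (∞ : OnePoint ℝ) = mapGL ℝ g • ∞ at h'
    rwa [← mul_smul, ← inv_smul_eq_iff, ← mul_smul, ← map_inv, ← map_mul, ← map_mul,
      mapGL_smul_infty_eq_self_iff, ← mul_assoc] at h'
  · rintro ⟨γ, hγ, h⟩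
    refine ⟨⟨mapGL ℝ γ, Subgroup.mem_map_of_mem (mapGL ℝ) hγ⟩, Subtype.ext ?_⟩
    change mapGL ℝ γ • mapGL ℝ g' • (∞ : OnePoint ℝ) = mapGL ℝ g • ∞
    rwa [← mul_smul, ← inv_smul_eq_iff, ← mul_smul, ← map_inv, ← map_mul, ← map_mul,
      mapGL_smul_infty_eq_self_iff, ← mul_assoc]

/-- **The `⟨T⟩`-orbits on `SL₂(ℤ)/Γ` are the cusps of `Γ`** when `-1 ∈ Γ`:
`gΓ ↦ Γ g⁻¹ ∞` is a bijection `⟨T⟩\(SL₂(ℤ)/Γ) ≃ Γ\ℙ¹(ℚ)`, so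
`#CuspOrbits(Γ) = #Level.basePoints(Γ)`. [cite: DiamondShurman2005, §3.8] -/
theorem card_cuspOrbits_eq_card_basePoints (hneg : (-1 : SL(2, ℤ)) ∈ Γ) :
    Nat.card (_root_.CuspOrbits (Γ : Subgroup (GL (Fin 2) ℝ))) = (basePoints Γ).card := by
  rw [← Nat.card_eq_finsetCard, ← Nat.card_congr (basePointsEquiv Γ)]
  symm
  -- the map `gΓ ↦ Γ g⁻¹ ∞`
  have hwd : ∀ a b : SL(2, ℤ), (a : SL(2, ℤ) ⧸ Γ) = b → cuspOrbitOf Γ a⁻¹ = cuspOrbitOf Γ b⁻¹ := by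
    intro a b hab
    rw [QuotientGroup.eq] at hab
    rw [cuspOrbitOf_eq_iff]
    exact ⟨a⁻¹ * b, hab, by simp⟩
  let ψ : SL(2, ℤ) ⧸ Γ → _root_.CuspOrbits (Γ : Subgroup (GL (Fin 2) ℝ)) :=
    Quotient.lift (fun g ↦ cuspOrbitOf Γ g⁻¹) fun a b hab ↦ hwd a b (Quotient.sound hab)
  have hψ : ∀ g : SL(2, ℤ), ψ (g : SL(2, ℤ) ⧸ Γ) = cuspOrbitOf Γ g⁻¹ := fun g ↦ rfl
  -- constant on `⟨T⟩`-orbits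
  have hT : ∀ (t : Subgroup.zpowers (T : SL(2, ℤ))) (q : SL(2, ℤ) ⧸ Γ), ψ (t • q) = ψ q := by
    rintro ⟨t, j, rfl⟩ q
    induction q using QuotientGroup.induction_on with
    | H g =>
      change ψ (((T ^ j * g : SL(2, ℤ))) : SL(2, ℤ) ⧸ Γ) = ψ g
      rw [hψ, hψ, cuspOrbitOf_eq_iff]
      refine ⟨1, one_mem _, ?_⟩
      simp [mul_inv_rev, coe_T_zpow]
  let ψ' : orbitRel.Quotient (Subgroup.zpowers (T : SL(2, ℤ))) (SL(2, ℤ) ⧸ Γ) →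
      _root_.CuspOrbits (Γ : Subgroup (GL (Fin 2) ℝ)) :=
    Quotient.lift ψ fun a b hab ↦ by
      obtain ⟨t, rfl⟩ := orbitRel_apply.mp hab
      exact hT t b
  refine Nat.card_eq_of_bijective ψ' ⟨?_, ?_⟩
  · intro a b hab
    induction a using Quotient.inductionOn with
    | h qa =>
    induction b using Quotient.inductionOn with
    | h qb =>
    induction qa using QuotientGroup.induction_on with
    | H g =>
    induction qb using QuotientGroup.induction_on with
    | H h =>
    change ψ g = ψ h at hab
    rw [hψ, hψ, cuspOrbitOf_eq_iff] at hab
    obtain ⟨γ, hγ, hzero⟩ := hab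
    rw [inv_inv] at hzero
    obtain ⟨j, hj⟩ := exists_eq_T_zpow_or_of_apply_one_zero hzero
    apply Quotient.sound
    refine orbitRel_apply.mpr ⟨⟨T ^ j, j, rfl⟩, ?_⟩
    change ((T ^ j * h : SL(2, ℤ)) : SL(2, ℤ) ⧸ Γ) = g
    rw [QuotientGroup.eq]
    have key : ∃ δ ∈ Γ, T ^ j * h = g * δ := by
      rcases hj with hj | hj
      · exact ⟨γ, hγ, by rw [← hj, inv_mul_cancel_right]⟩
      · refine ⟨-γ, by rw [← neg_one_mul]; exact mul_mem hneg hγ, ?_⟩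
        have hT' : T ^ j = -(g * γ * h⁻¹) := by rw [hj, neg_neg]
        rw [hT', neg_mul, inv_mul_cancel_right, mul_neg]
    obtain ⟨δ, hδ, hkey⟩ := key
    rw [hkey, mul_inv_rev, mul_assoc, inv_mul_cancel, mul_one]
    exact inv_mem hδ
  · rintro c
    obtain ⟨g, rfl⟩ := cuspOrbitOf_surjective Γ c
    exact ⟨⟦((g⁻¹ : SL(2, ℤ)) : SL(2, ℤ) ⧸ Γ)⟧, (hψ g⁻¹).trans (by rw [inv_inv])⟩

/-- **The cusps of `Γ` and of `±Γ` coincide, and so do their orbits**: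
`#CuspOrbits(Γ) = #CuspOrbits(±Γ)` (`-γ` acts as `γ` on `ℙ¹`). [folklore] -/
theorem card_cuspOrbits_eq_adjoinNegI :
    Nat.card (_root_.CuspOrbits (Γ : Subgroup (GL (Fin 2) ℝ))) =
      Nat.card (_root_.CuspOrbits (adjoinNegI Γ : Subgroup (GL (Fin 2) ℝ))) := by
  haveI : (adjoinNegI Γ).FiniteIndex := Subgroup.finiteIndex_of_le (le_adjoinNegI (Γ := Γ))
  -- the cusp sets agree
  have hcusp : ∀ c : OnePoint ℝ, IsCusp c (Γ : Subgroup (GL (Fin 2) ℝ)) ↔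
      IsCusp c (adjoinNegI Γ : Subgroup (GL (Fin 2) ℝ)) := fun c ↦ by
    rw [Subgroup.IsArithmetic.isCusp_iff_isCusp_SL2Z (Γ : Subgroup (GL (Fin 2) ℝ)),
      Subgroup.IsArithmetic.isCusp_iff_isCusp_SL2Z (adjoinNegI Γ : Subgroup (GL (Fin 2) ℝ))]
  let e : cuspsSubMulAction (Γ : Subgroup (GL (Fin 2) ℝ)) ≃
      cuspsSubMulAction (adjoinNegI Γ : Subgroup (GL (Fin 2) ℝ)) :=
    { toFun := fun c ↦ ⟨c.1, (hcusp c.1).mp c.2⟩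
      invFun := fun c ↦ ⟨c.1, (hcusp c.1).mpr c.2⟩
      left_inv := fun c ↦ rfl
      right_inv := fun c ↦ rfl }
  -- the orbit relations agree
  have hrel : ∀ c c' : cuspsSubMulAction (Γ : Subgroup (GL (Fin 2) ℝ)),
      orbitRel (Γ : Subgroup (GL (Fin 2) ℝ)) _ c c' ↔
        orbitRel (adjoinNegI Γ : Subgroup (GL (Fin 2) ℝ)) _ (e c) (e c') := by
    intro c c'
    rw [orbitRel_apply, orbitRel_apply, mem_orbit_iff, mem_orbit_iff]
    constructor
    · rintro ⟨⟨_, γ, hγ, rfl⟩, h⟩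
      refine ⟨⟨mapGL ℝ γ, Subgroup.mem_map_of_mem (mapGL ℝ) (le_adjoinNegI hγ)⟩, Subtype.ext ?_⟩
      change mapGL ℝ γ • (c'.1 : OnePoint ℝ) = c.1
      exact congrArg Subtype.val h
    · rintro ⟨⟨_, γ, hγ, rfl⟩, h⟩
      have h' : mapGL ℝ γ • (c'.1 : OnePoint ℝ) = c.1 := congrArg Subtype.val h
      rcases hγ with hγ | hγ
      · exact ⟨⟨mapGL ℝ γ, Subgroup.mem_map_of_mem (mapGL ℝ) hγ⟩, Subtype.ext h'⟩
      · refine ⟨⟨mapGL ℝ (-γ), Subgroup.mem_map_of_mem (mapGL ℝ) hγ⟩, Subtype.ext ?_⟩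
        change mapGL ℝ (-γ) • (c'.1 : OnePoint ℝ) = c.1
        rw [mapGL_neg, OnePoint.neg_smul']
        exact h'
  exact Nat.card_congr (Quotient.congr e hrel)

end CuspOrbits

end Level

/-! ### The cusps of `Γ₁(N)` -/

section Gamma1

variable (N : ℕ)

/-- **The number of cusps of `Γ₁(N)` is the `⟨T⟩`-orbit count on `SL₂(ℤ)/±Γ₁(N)`**:
`#CuspOrbits(Γ₁(N)) = #Level.basePoints(±Γ₁(N))` — the `ε_∞` of
`le_twelve_mul_finrank_cuspForm_gamma1` (`ModularFormsGamma1Dimension`). [cite: DiamondShurman2005, §3.8] -/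
theorem card_cuspOrbits_gamma1 [NeZero N] :
    Nat.card (CuspOrbits (Gamma1 N : Subgroup (GL (Fin 2) ℝ))) =
      (Level.basePoints (Gamma1pm N)).card := by
  rw [Level.card_cuspOrbits_eq_adjoinNegI (Gamma1 N)]
  exact Level.card_cuspOrbits_eq_card_basePoints (Gamma1pm N) (neg_one_mem_gamma1pm N)

end Gamma1

end Literature.NumberTheory.EllipticCurves.ModularForms
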